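import Literature.AlgebraicGeometry.Deformation.SmoothAffineDeformationsTrivial
import Literature.AlgebraicGeometry.Deformation.MorphismLiftsSquareZeroSmoothAffine
import Literature.AlgebraicGeometry.Morphisms.FibreChartRing
import Literature.AlgebraicGeometry.Motives.Differentials
import Mathlib.AlgebraicGeometry.Morphisms.Flat
import HarnessLib

/-!
# The affine charts of a flat deformation over an Artinian base are trivial: `Γ(Y, W) ≅ A ⊗_k Γ(X, i⁻¹W)`
# (Hartshorne, *Deformation Theory*, Cor. 4.8 at the level of schemes; proof of Thm. 10.2 (a): «`U'_i ≅ U_i ×_k Spec A'`»)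

Layer `Literature/AlgebraicGeometry/Deformation` (THEOREMS only); second file (c2a) of the F3c DICTIONARY «an actual flat
deformation ↦ cocycle-exact gluing data» (cell `hodgecm-mathlib`, F-11 (A3), B-p21 (g20)).  Setting: `k` a field, `A` an
Artinian local `k`-algebra with augmentation `π : A → k`; `X → Spec k` (the closed fibre, with the ★ K1 convention
`[∀ W, Algebra k Γ(X, W)]` + `halg`); `Y → Spec A` FLAT; `i : X → Y` with `X = Y ×_{Spec A} Spec k` (`IsPullback i X.hom Y.hom (Spec π)`).

* §1 `ker_includeRight_of_surjective` — for `A → k'` onto, `b ↦ 1 ⊗ b : B' → k' ⊗_A B'` has kernel `(ker)B'` (Mathlib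
  `Algebra.TensorProduct.rTensor_ker`);
* §2 `app_structureMap` (the closed-fibre map `i^♯_W : Γ(Y, W) → Γ(X, i⁻¹W)` sends the `A`-scalars to the `k`-scalars via `π`),
  `app_surjective`, `ker_app` (it is ONTO with kernel `𝔪_A Γ(Y, W)` for affine `W` — ★ `FibreChartRing.fibreChartIso`);
* §3 **`exists_chart_trivialisation`** — for `X → Spec k` SMOOTH and `W ⊆ Y` affine: a ring isomorphism
  `e : A ⊗_k Γ(X, i⁻¹W) ≃ Γ(Y, W)` with `e (a ⊗ 1) = a|_W` and `i^♯(e (a ⊗ s)) = π(a) s` (★ Cor. 4.8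
  `exists_algEquiv_of_formallySmooth_of_flat_of_isArtinianRing`, fed with ★ `formallySmooth_sections_of_smooth` and Mathlib's
  `HasRingHomProperty @Flat`).

HC_CM is proved only modulo the 7 printed citations until rung 0 closes — nothing here bears on a summit statement.

## References
* [Hartshorne2010] R. Hartshorne, *Deformation Theory*, GTM 257, Springer (2010): Cor. 4.8 (pp. 32–33); Thm. 10.2 (a) and
  its proof (p. 81).
* [GortzWedhorn2020] U. Görtz, T. Wedhorn, *Algebraic Geometry I*, 2nd ed. (2020): Prop. 4.20 (`Spec A ×_R Spec B`).
* [AtiyahMacdonald1969] M. F. Atiyah, I. G. Macdonald, *Introduction to Commutative Algebra* (1969): Ex. 2.2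
  (`(A/𝔞) ⊗_A M ≅ M/𝔞M`).
-/

noncomputable section

-- `TopCat.Presheaf`/`TopCat.Sheaf` are not reducible (as in Mathlib's `AlgebraicGeometry/Modules`).
set_option backward.isDefEq.respectTransparency false

open CategoryTheory AlgebraicGeometry Opposite TopologicalSpace Limits
open scoped TensorProduct

universe u

namespace Literature.AlgebraicGeometry.Deformation

open Literature.AlgebraicGeometry.Motives Literature.AlgebraicGeometry.Morphisms SmoothAffineDeformation

/-! ## §1 The kernel of `b ↦ 1 ⊗ b : B' → k' ⊗_A B'` -/

/-- For `A → k'` surjective, `b ↦ 1 ⊗ b : B' → k' ⊗_A B'` has kernel `ker(A → k') · B'` (`k' ⊗_A B' = B'/𝔪B'`).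
[cite: AtiyahMacdonald1969, Ex. 2.2] -/
theorem ker_includeRight_of_surjective {A k' B' : Type u} [CommRing A] [CommRing k'] [Algebra A k'] [CommRing B']
    [Algebra A B'] (h : Function.Surjective (algebraMap A k')) :
    RingHom.ker (Algebra.TensorProduct.includeRight (R := A) (A := k') (B := B')).toRingHom =
      (RingHom.ker (algebraMap A k')).map (algebraMap A B') := by
  apply le_antisymm
  · intro b hb
    rw [RingHom.mem_ker] at hb
    change (1 : k') ⊗ₜ[A] b = 0 at hb
    have hx : ((1 : A) ⊗ₜ[A] b) ∈ RingHom.ker (Algebra.TensorProduct.map (Algebra.ofId A k') (AlgHom.id A B')) := by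
      rw [RingHom.mem_ker, Algebra.TensorProduct.map_tmul, map_one, AlgHom.id_apply, hb]
    have h' : Function.Surjective (Algebra.ofId A k') := h
    rw [Algebra.TensorProduct.rTensor_ker _ h'] at hx
    have hle : (RingHom.ker (Algebra.ofId A k')).map
        (Algebra.TensorProduct.includeLeft (R := A) (S := A) (A := A) (B := B')) ≤
        ((RingHom.ker (algebraMap A k')).map (algebraMap A B')).comap
          (Algebra.TensorProduct.lid A B').toAlgHom.toRingHom := by
      rw [Ideal.map_le_iff_le_comap]
      intro a ha
      rw [Ideal.mem_comap, Ideal.mem_comap]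
      change Algebra.TensorProduct.lid A B' (a ⊗ₜ 1) ∈ _
      rw [Algebra.TensorProduct.lid_tmul, Algebra.smul_def, mul_one]
      exact Ideal.mem_map_of_mem _ ha
    have hb' := hle hx
    rw [Ideal.mem_comap] at hb'
    change Algebra.TensorProduct.lid A B' (1 ⊗ₜ b) ∈ _ at hb'
    rwa [Algebra.TensorProduct.lid_tmul, one_smul] at hb'
  · rw [Ideal.map_le_iff_le_comap]
    intro a ha
    rw [Ideal.mem_comap, RingHom.mem_ker, AlgHom.toRingHom_eq_coe, RingHom.coe_coe, AlgHom.commutes,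
      Algebra.TensorProduct.algebraMap_apply, RingHom.mem_ker.mp ha, TensorProduct.zero_tmul]

/-! ## §2 The closed-fibre map of a chart -/

variable {k : Type u} [Field k] {A : Type u} [CommRing A] [Algebra k A] (π : A →ₐ[k] k)
  {X : Over (Spec (CommRingCat.of k))} [instΓ : ∀ W : X.left.Opens, Algebra k Γ(X.left, W)]
  (halg : ∀ (W : X.left.Opens) (s : k), algebraMap k Γ(X.left, W) s = (constToPresheaf X).app (op W) s)
  {Y : Over (Spec (CommRingCat.of A))} (i : X.left ⟶ Y.left)
  (hi : IsPullback i X.hom Y.hom (Spec.map (CommRingCat.ofHom π.toRingHom)))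

include halg in
omit π i hi in
/-- The structure map `k → Γ(U)` of an open of the `k`-scheme `X`, as a morphism (★ K1 convention `halg`).
[cite: Hartshorne1977, II.8 p. 172 (the `k`-structure of `𝒪_X`)] -/
private theorem ofHom_algebraMap_eq' (V : X.left.Opens) :
    CommRingCat.ofHom (algebraMap k Γ(X.left, V)) = (Scheme.ΓSpecIso (CommRingCat.of k)).inv ≫ X.hom.appLE ⊤ V le_top := by
  apply CommRingCat.hom_ext
  refine RingHom.ext fun s => ?_
  exact halg V s

include hi halg in
/-- **The closed-fibre map sends `A`-scalars to `k`-scalars through `π`**: `i^♯_W (a|_W) = π(a)|_{i⁻¹W}`.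
[cite: Hartshorne2010, Thm. 10.2 (proof), p. 81] -/
theorem app_structureMap (W : Y.left.Opens) (a : A) :
    i.app W (Y.hom.appLE ⊤ W le_top ((Scheme.ΓSpecIso (CommRingCat.of A)).inv a)) = algebraMap k Γ(X.left, i ⁻¹ᵁ W) (π a) := by
  have h1 : Y.hom.appLE ⊤ W le_top ≫ i.app W = (Spec.map (CommRingCat.ofHom π.toRingHom)).appLE ⊤ ⊤ le_top ≫
      X.hom.appLE ⊤ (i ⁻¹ᵁ W) le_top := by
    rw [Scheme.Hom.app_eq_appLE, Scheme.Hom.appLE_comp_appLE, hi.w, Scheme.Hom.appLE_comp_appLE]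
  have h2 : ((Scheme.ΓSpecIso (CommRingCat.of A)).inv ≫ (Spec.map (CommRingCat.ofHom π.toRingHom)).appLE ⊤ ⊤ le_top) a =
      (Scheme.ΓSpecIso (CommRingCat.of k)).inv (π a) := by
    change ((Scheme.ΓSpecIso (CommRingCat.of A)).inv ≫ (Spec.map (CommRingCat.ofHom π.toRingHom)).appTop) a = _
    rw [← Scheme.ΓSpecIso_inv_naturality]
    rfl
  calc i.app W (Y.hom.appLE ⊤ W le_top ((Scheme.ΓSpecIso (CommRingCat.of A)).inv a))
      = (Y.hom.appLE ⊤ W le_top ≫ i.app W) ((Scheme.ΓSpecIso (CommRingCat.of A)).inv a) := rfl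
    _ = X.hom.appLE ⊤ (i ⁻¹ᵁ W) le_top (((Scheme.ΓSpecIso (CommRingCat.of A)).inv ≫
          (Spec.map (CommRingCat.ofHom π.toRingHom)).appLE ⊤ ⊤ le_top) a) := by rw [h1]; rfl
    _ = ((Scheme.ΓSpecIso (CommRingCat.of k)).inv ≫ X.hom.appLE ⊤ (i ⁻¹ᵁ W) le_top) (π a) := by rw [h2]; rfl
    _ = algebraMap k Γ(X.left, i ⁻¹ᵁ W) (π a) := by rw [← ofHom_algebraMap_eq' halg]; rfl

omit instΓ in
include hi in
/-- **The closed-fibre map of an affine chart is onto** (`Γ(X, i⁻¹W) = k ⊗_A Γ(Y, W)`, ★ `fibreChartIso`, and `A → k` is onto).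
[cite: GortzWedhorn2020, Prop. 4.20] [cite: Hartshorne2010, Cor. 4.8, p. 32] -/
theorem app_surjective {W : Y.left.Opens} (hW : IsAffineOpen W) : Function.Surjective (i.app W) := by
  letI : Algebra A k := π.toRingHom.toAlgebra
  have hπ : Function.Surjective (algebraMap A k) := fun c => ⟨algebraMap k A c, π.commutes c⟩
  intro s
  obtain ⟨x, hx⟩ := (fibreChartIso Y.hom i X.hom hi hW).surjective s
  obtain ⟨b, rfl⟩ := Algebra.TensorProduct.includeRight_surjective (ChartRing Y.hom W) hπ x
  exact ⟨ChartRing.val b, by rw [← hx]; exact (fibreChartIso_one_tmul Y.hom i X.hom hi hW b).symm⟩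

omit instΓ in
include hi in
/-- **Its kernel is `𝔪_A · Γ(Y, W)`** (`𝔪_A = ker π`). [cite: GortzWedhorn2020, Prop. 4.20] [cite: AtiyahMacdonald1969, Ex. 2.2] -/
theorem ker_app {W : Y.left.Opens} (hW : IsAffineOpen W) :
    RingHom.ker (i.app W).hom = (RingHom.ker π).map ((Y.hom.appLE ⊤ W le_top).hom.comp
      (Scheme.ΓSpecIso (CommRingCat.of A)).inv.hom) := by
  letI : Algebra A k := π.toRingHom.toAlgebra
  have hπ : Function.Surjective (algebraMap A k) := fun c => ⟨algebraMap k A c, π.commutes c⟩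
  have h1 : (i.app W).hom = (fibreChartIso Y.hom i X.hom hi hW).toRingHom.comp
      (Algebra.TensorProduct.includeRight (R := A) (A := k) (B := ChartRing Y.hom W)).toRingHom :=
    RingHom.ext fun b => (fibreChartIso_one_tmul Y.hom i X.hom hi hW b).symm
  apply le_antisymm
  · intro b hb
    have hb' : b ∈ RingHom.ker (Algebra.TensorProduct.includeRight (R := A) (A := k) (B := ChartRing Y.hom W)).toRingHom := by
      rw [RingHom.mem_ker] at hb ⊢
      rw [h1, RingHom.comp_apply] at hb
      exact (map_eq_zero_iff _ (fibreChartIso Y.hom i X.hom hi hW).injective).mp hb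
    rw [ker_includeRight_of_surjective hπ] at hb'
    exact hb'
  · rw [Ideal.map_le_iff_le_comap]
    intro a ha
    rw [Ideal.mem_comap, RingHom.mem_ker, h1, RingHom.comp_apply]
    have ha' : algebraMap A (ChartRing Y.hom W) a ∈ RingHom.ker
        (Algebra.TensorProduct.includeRight (R := A) (A := k) (B := ChartRing Y.hom W)).toRingHom := by
      rw [ker_includeRight_of_surjective hπ]
      exact Ideal.mem_map_of_mem _ ha
    rw [RingHom.mem_ker] at ha'
    change (fibreChartIso Y.hom i X.hom hi hW).toRingHom
      ((Algebra.TensorProduct.includeRight (R := A) (A := k) (B := ChartRing Y.hom W)).toRingHom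
        (algebraMap A (ChartRing Y.hom W) a)) = 0
    rw [ha', map_zero]

/-! ## §3 The chart trivialisation -/

include hi halg in
/-- **THE AFFINE CHARTS OF A FLAT DEFORMATION ARE TRIVIAL** ([Hartshorne2010] Cor. 4.8 for schemes: «`X'` is isomorphic to
the trivial deformation»; proof of Thm. 10.2 (a): «`U'_i ≅ U_i ×_k Spec A'`»): for `X → Spec k` smooth, `Y → Spec A` flat
over the Artinian local `A`, closed fibre `i : X → Y` along `π`, and an affine `W ⊆ Y`, there is a ring isomorphism
`e : A ⊗_k Γ(X, i⁻¹W) ≃ Γ(Y, W)` extending the `A`-structure (`e (a ⊗ 1) = a|_W`) and lying over the closed fibres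
(`i^♯(e(a ⊗ s)) = π(a) s`). [cite: Hartshorne2010, Cor. 4.8, pp. 32–33; Thm. 10.2 (proof), p. 81] -/
theorem exists_chart_trivialisation [IsArtinianRing A] [IsLocalRing A] [Smooth X.hom] [Flat Y.hom]
    {W : Y.left.Opens} (hW : IsAffineOpen W) :
    ∃ e : A ⊗[k] Γ(X.left, i ⁻¹ᵁ W) ≃+* Γ(Y.left, W),
      (∀ a : A, e (a ⊗ₜ 1) = Y.hom.appLE ⊤ W le_top ((Scheme.ΓSpecIso (CommRingCat.of A)).inv a)) ∧
      (∀ (a : A) (s : Γ(X.left, i ⁻¹ᵁ W)), i.app W (e (a ⊗ₜ s)) = π a • s) := by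
  letI : Algebra A k := π.toRingHom.toAlgebra
  -- the `A`- and `k`-algebra structures of `Γ(Y, W)`
  letI algA : Algebra A Γ(Y.left, W) :=
    ((Y.hom.appLE ⊤ W le_top).hom.comp (Scheme.ΓSpecIso (CommRingCat.of A)).inv.hom).toAlgebra
  letI algk : Algebra k Γ(Y.left, W) := ((algebraMap A Γ(Y.left, W)).comp (algebraMap k A)).toAlgebra
  haveI : IsScalarTower k A Γ(Y.left, W) := IsScalarTower.of_algebraMap_eq fun _ => rfl
  -- flatness of the chart ring over `A`
  haveI : Module.Flat A Γ(Y.left, W) := by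
    have h1 : (Y.hom.appLE ⊤ W le_top).hom.Flat :=
      HasRingHomProperty.appLE @Flat Y.hom inferInstance ⟨⊤, isAffineOpen_top _⟩ ⟨W, hW⟩ le_top
    have h2 : ((Scheme.ΓSpecIso (CommRingCat.of A)).inv ≫ Y.hom.appLE ⊤ W le_top).hom.Flat :=
      (RingHom.Flat.respectsIso.cancel_left_isIso (Scheme.ΓSpecIso (CommRingCat.of A)).inv
        (Y.hom.appLE ⊤ W le_top)).mpr h1
    exact h2
  -- formal smoothness of the closed-fibre chart ring (★, transported to the K1 algebra structure via `halg`)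
  haveI : Algebra.FormallySmooth k Γ(X.left, i ⁻¹ᵁ W) := by
    have hsm := formallySmooth_sections_of_smooth X.hom (isAffineOpen_preimage_of_isPullback Y.hom i X.hom hi hW)
    have heq : ((Scheme.ΓSpecIso (CommRingCat.of k)).inv ≫ X.hom.appLE ⊤ (i ⁻¹ᵁ W) le_top).hom.toAlgebra =
        instΓ (i ⁻¹ᵁ W) :=
      Algebra.algebra_ext _ _ fun s => by
        rw [RingHom.algebraMap_toAlgebra, ← ofHom_algebraMap_eq' halg]
        rfl
    rw [heq] at hsm
    exact hsm
  -- the closed-fibre map as a `k`-algebra map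
  let ρ : Γ(Y.left, W) →ₐ[k] Γ(X.left, i ⁻¹ᵁ W) :=
    { (i.app W).hom with
      commutes' := fun c => by
        change i.app W (Y.hom.appLE ⊤ W le_top ((Scheme.ΓSpecIso (CommRingCat.of A)).inv (algebraMap k A c))) =
          algebraMap k Γ(X.left, i ⁻¹ᵁ W) c
        rw [app_structureMap π halg i hi, AlgHom.commutes, Algebra.algebraMap_self, RingHom.id_apply] }
  have hρ : Function.Surjective ρ := app_surjective π i hi hW
  have hker : RingHom.ker ρ = (RingHom.ker π).map (algebraMap A Γ(Y.left, W)) := ker_app π i hi hW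
  obtain ⟨e, he⟩ := exists_algEquiv_of_formallySmooth_of_flat_of_isArtinianRing π ρ hρ hker
  refine ⟨e.toRingEquiv, fun a => ?_, fun a s => he a s⟩
  change e (a ⊗ₜ 1) = algebraMap A Γ(Y.left, W) a
  rw [← e.commutes a, Algebra.TensorProduct.algebraMap_apply, Algebra.algebraMap_self, RingHom.id_apply]

end Literature.AlgebraicGeometry.Deformation

end
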